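import Literature.RingTheory.MvPowerSeries.HasseDerivExactOrder
import Literature.RingTheory.MvPowerSeries.DiagonalForms
import Literature.AlgebraicGeometry.Resolution.AdicOrderBasics
import Mathlib
import HarnessLib

/-!
# Divided (Hasse) derivatives of order `ord f − 1`: their LINEAR PARTS, and when they reach order exactly `1`

Topic `Literature/RingTheory/MvPowerSeries`, sequel of `HasseDerivExactOrder.lean` (a divided derivative of order `ord f` reaches a
UNIT) and `AdicTaylor.lean` (`hasseDeriv α = Δ_α`, `coeff β (Δ_α f) = C(α+β, α) · coeff (α+β) f`, Bourbaki's (21)). Everything here is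
PROVED; no definition, no named fact. Content (for `f ∈ K⟦x_σ⟧`, `K` a field of characteristic `p`, `p` a prime OR `0`):

* `prod_choose_add_single`, `coeff_single_hasseDeriv` (any commutative ring): the coefficient of `x_i` in `Δ_α f` is
  `(α_i + 1) · coeff_{α + e_i} f` — the multi-index binomial `C(α + e_i, α)` is `α_i + 1`;
* `forall_hasseDeriv_mem_sq_iff` — for `δ ≤ ord f`: **every divided derivative of order `< δ` lies in `𝔪²`** (i.e. has no constant
  and no linear part) **iff every monomial `x^β` of the degree-`δ` homogeneous part of `f` has ALL its exponents divisible by `p`**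
  (the degree-`δ` form lies in `K[x_1^p, …, x_n^p]`; for `p = 0` this says the form is constant, i.e. zero when `δ ≥ 1`). Only the
  derivatives of order exactly `δ − 1` matter, and only through their linear parts `(β_i) · coeff_β f · x_i`, `β = α + e_i`;
* `exists_hasseDeriv_adicOrder_eq_one` — conversely, if some degree-`δ` monomial of `f` (`δ ≤ ord f`) has an exponent `β_i` prime to
  `p`, then `Δ_{β − e_i} f` has `𝔪`-adic order EXACTLY `1` (it lies in `𝔪 ∖ 𝔪²`); `exists_hasseDeriv_adicOrder_eq_one_of_not_dvd_order`
  — in particular whenever `p ∤ ord f` (`exists_not_dvd_of_not_dvd_degree`: a multi-index of total degree prime to `p` has a coordinate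
  prime to `p` — private helper); `exists_hasseDeriv_adicOrder_eq_one_charZero` — always in characteristic `0` (`ord f ≥ 1` finite).

Source read on the page for the surrounding language (held text `paper:arxiv-math_0606795`, chunk p0009 L1–L24): O. Villamayor U., *Rees
algebras on smooth schemes: integral closure and higher differential operators*, Rev. Mat. Iberoam. 24 (2008) [VillamayorU2008ReesDiff],
§4.1 («`(Diff^{b−1}_k(I))_x = ⟨Δ^α(f) / f ∈ I, 0 ≤ |α| ≤ b−1⟩` … `Diff^{b−1}_k(I)` is a proper ideal if and only if `I` has order at least
`b`»): the present file decides when that proper ideal is moreover contained in `𝔪²` at the complete model `K⟦x⟧` — exactly when the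
initial forms are `p`-th power forms. The divided derivatives are Bourbaki's [Bourbaki1989CommAlg] Ch. III §4 no. 5 (21). The
equivalence itself is an elementary coefficient computation (folklore; it is the formal-power-series form of the classical remark that a
hypersurface of order `b` admits an order-one derivative of order `b − 1` — a «maximal contact» coordinate candidate — unless its tangent
form is a `p`-th power form).

Bearing (index only; nothing from it is used or asserted): H. Hironaka, *Resolution of singularities in positive characteristics* (ms.
2017, unrefereed manuscript under adjudication, campaign res-hironaka; lit key `paper:url-3343fd9e678b`), §6.3 p.33 Eq. (53) / GAP row R96,
Tier-B item E9 «LL-head desert»: at a typed core focus `Ě` of `Ê = (J, b̂)` one has `J ≤ ℘(Ě, b̂) = 𝓘_{Sing Ě}^{⟨b̂⟩}`, so a desert point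
`ξ ∈ Sing(Ě)` (`𝓘_{Sing Ě, ξ} ⊆ 𝔪_ξ²`) forces the divided derivatives of order `≤ b̂ − 1` of `J_ξ` into `𝔪_ξ²`; by (ii)/(iii) (at the complete
model) this puts every order-`b̂` element of `J_ξ` in the WILD regime «initial form ∈ K[x^p]», in particular `p ∣ b̂`. Deliberately NOT here
(same scope note as `HasseDerivExactOrder.lean`): the Cohen isomorphism `Ô_{Z,ξ} ≅ κ(ξ)⟦x⟧` and the action of `Diff_Z` on the completion.
-/

noncomputable section

open _root_.MvPowerSeries Finsupp IsLocalRing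

namespace Literature.RingTheory.MvPowerSeries

universe u v

/-! ## The linear part of a divided derivative (any commutative ring) -/

section AnyRing

variable {A : Type u} [CommRing A] {τ : Type v}

/-- **The multi-index binomial at a unit vector**: `C(α + e_i, α) = Π_s C(α_s + δ_{s,i}, α_s) = α_i + 1`.
[cite: Bourbaki1989CommAlg, Ch. III §4 no. 5 (21)] -/
theorem prod_choose_add_single (α : τ →₀ ℕ) (i : τ) :
    ((α + single i 1).prod fun s n => n.choose (α s)) = α i + 1 := by
  classical
  rw [Finsupp.prod, Finset.prod_eq_single i]
  · rw [Finsupp.add_apply, single_eq_same, Nat.choose_succ_self_right]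
  · intro s _ hsi
    rw [Finsupp.add_apply, Finsupp.single_apply, if_neg (Ne.symm hsi), add_zero, Nat.choose_self]
  · intro hi
    exfalso
    rw [Finsupp.mem_support_iff, Finsupp.add_apply, single_eq_same] at hi
    omega

/-- **The coefficient of `x_i` in `Δ_α f` is `(α_i + 1) · coeff_{α+e_i} f`** — the linear part of a divided derivative of order `|α|`
reads the degree-`(|α|+1)` coefficients of `f`, weighted by the exponents `(α + e_i)_i = α_i + 1`.
[cite: Bourbaki1989CommAlg, Ch. III §4 no. 5 (21)] -/
theorem coeff_single_hasseDeriv (α : τ →₀ ℕ) (i : τ) (f : MvPowerSeries τ A) :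
    coeff (single i 1) (hasseDeriv α f) = ((α i + 1 : ℕ) : A) * coeff (α + single i 1) f := by
  rw [coeff_hasseDeriv, prod_choose_add_single]

/-- A multi-index of total degree prime to `p` has a coordinate prime to `p` (contrapositive of `p ∣ Σ_i β_i`); private
arithmetic helper. [folklore] -/
private theorem exists_not_dvd_of_not_dvd_degree {p : ℕ} {β : τ →₀ ℕ} (h : ¬ p ∣ β.degree) : ∃ i, ¬ p ∣ β i := by
  by_contra hall
  simp only [not_exists, not_not] at hall
  exact h (by rw [Finsupp.degree_apply]; exact Finset.dvd_sum fun i _ => hall i)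

end AnyRing

/-! ## Over a field of characteristic `p`: all derivatives of order `< δ` in `𝔪²` iff the degree-`δ` form is a `p`-th power form -/

section Field

variable {K : Type u} [Field K] {σ : Type v} (p : ℕ) [CharP K p]

omit [CharP K p] in
/-- If `Δ_α f ∈ 𝔪²` then its `x_i`-coefficient vanishes: `(α_i + 1) · coeff_{α+e_i} f = 0` in `K`.
[cite: VillamayorU2008ReesDiff, §4.1 (the ideal of divided derivatives of order `≤ b − 1`; kernel coefficient bookkeeping)] -/
theorem natCast_mul_coeff_eq_zero_of_hasseDeriv_mem_sq {f : MvPowerSeries σ K} {α : σ →₀ ℕ} (i : σ)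
    (h : hasseDeriv α f ∈ maximalIdeal (MvPowerSeries σ K) ^ 2) :
    ((α i + 1 : ℕ) : K) * coeff (α + single i 1) f = 0 := by
  rw [← coeff_single_hasseDeriv]
  exact Jets.coeff_eq_zero_of_mem_maximalIdeal_pow h (by rw [degree_single]; norm_num)

/-- **MAIN EQUIVALENCE.** For `f ∈ K⟦x_σ⟧` with `δ ≤ ord f` (`K` a field with `CharP K p`, `p` prime or `0`): every divided derivative
`Δ_α f` of order `|α| < δ` lies in `𝔪²` **iff** every monomial `x^β` of total degree `δ` occurring in `f` has all exponents `β_i`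
divisible by `p` (the degree-`δ` form of `f` lies in `K[x_1^p, …, x_n^p]`). `⇒`: for `β_i ≥ 1` read the `x_i`-coefficient
`β_i · coeff_β f` of `Δ_{β−e_i} f ∈ 𝔪²` (`natCast_mul_coeff_eq_zero_of_hasseDeriv_mem_sq`, `CharP.cast_eq_zero_iff`). `⇐`: a coefficient
of `Δ_α f` in degree `≤ 1` is `C · coeff_{α+e} f` with `|α + e| ≤ δ`; below `δ` it vanishes (`δ ≤ ord f`), in degree `δ` it is
`(α+e_i)_i · coeff_{α+e_i} f = 0`. [cite: VillamayorU2008ReesDiff, §4.1 (setting; the equivalence is an elementary coefficient computation — folklore)] -/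
theorem forall_hasseDeriv_mem_sq_iff [Finite σ] {f : MvPowerSeries σ K} {δ : ℕ} (hf : (δ : ℕ∞) ≤ f.order) :
    (∀ α : σ →₀ ℕ, α.degree < δ → hasseDeriv α f ∈ maximalIdeal (MvPowerSeries σ K) ^ 2) ↔
      ∀ β : σ →₀ ℕ, β.degree = δ → coeff β f ≠ 0 → ∀ i, p ∣ β i := by
  constructor
  · intro h β hβ hc i
    by_cases hi : β i = 0
    · rw [hi]; exact dvd_zero p
    · have hle : single i 1 ≤ β := Finsupp.single_le_iff.mpr (Nat.one_le_iff_ne_zero.mpr hi)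
      obtain ⟨α, rfl⟩ : ∃ α, β = α + single i 1 := ⟨β - single i 1, (tsub_add_cancel_of_le hle).symm⟩
      have hα : α.degree < δ := by rw [← hβ, map_add, degree_single]; omega
      rcases mul_eq_zero.mp (natCast_mul_coeff_eq_zero_of_hasseDeriv_mem_sq i (h α hα)) with h2 | h2
      · rw [Finsupp.add_apply, single_eq_same]
        exact (CharP.cast_eq_zero_iff K p _).mp h2
      · exact absurd h2 hc
  · intro h α hα
    refine Jets.mem_maximalIdeal_pow_of_coeff_eq_zero fun e he => ?_
    rw [coeff_hasseDeriv]
    by_cases hlt : (α + e).degree < δ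
    · rw [MvPowerSeries.coeff_of_lt_order (lt_of_lt_of_le (by exact_mod_cast hlt) hf), mul_zero]
    · have hdeg : (α + e).degree = δ ∧ e.degree = 1 := by rw [map_add] at hlt ⊢; omega
      obtain ⟨i, rfl⟩ := DiagonalForms.exists_eq_single_of_degree_eq_one hdeg.2
      rw [prod_choose_add_single]
      by_cases hc : coeff (α + single i 1) f = 0
      · rw [hc, mul_zero]
      · have hdvd := h (α + single i 1) hdeg.1 hc i
        rw [Finsupp.add_apply, single_eq_same] at hdvd
        rw [(CharP.cast_eq_zero_iff K p _).mpr hdvd, zero_mul]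

/-- **An exponent prime to `p` in degree `δ ≤ ord f` gives a divided derivative of order `δ − 1` with `𝔪`-adic order EXACTLY `1`**:
if `coeff_β f ≠ 0`, `|β| = δ ≤ ord f` and `p ∤ β_i`, then `Δ_{β−e_i} f ∈ 𝔪 ∖ 𝔪²` — its constant term is `coeff_{β−e_i} f = 0` (degree
`< ord f`) and its `x_i`-coefficient is `β_i · coeff_β f ≠ 0`. (The tree's `adicOrder`; on `K⟦x_σ⟧`, `σ` finite, it is `MvPowerSeries.order`,
`adicOrder_eq_order`.) [cite: VillamayorU2008ReesDiff, §4.1 (element form; folklore computation)] -/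
theorem exists_hasseDeriv_adicOrder_eq_one {f : MvPowerSeries σ K} {δ : ℕ} (hf : (δ : ℕ∞) ≤ f.order) {β : σ →₀ ℕ}
    (hβ : β.degree = δ) (hc : coeff β f ≠ 0) {i : σ} (hi : ¬ p ∣ β i) :
    ∃ α : σ →₀ ℕ, α + single i 1 = β ∧ α.degree + 1 = δ ∧
      Literature.AlgebraicGeometry.Resolution.adicOrder (hasseDeriv α f) = 1 := by
  have hi0 : β i ≠ 0 := fun h0 => hi (h0 ▸ dvd_zero p)
  have hle : single i 1 ≤ β := Finsupp.single_le_iff.mpr (Nat.one_le_iff_ne_zero.mpr hi0)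
  obtain ⟨α, rfl⟩ : ∃ α, β = α + single i 1 := ⟨β - single i 1, (tsub_add_cancel_of_le hle).symm⟩
  have hαδ : α.degree + 1 = δ := by rw [← hβ, map_add, degree_single]
  refine ⟨α, rfl, hαδ, ?_⟩
  rw [Literature.AlgebraicGeometry.Resolution.adicOrder_eq_one_iff]
  constructor
  · -- constant term `coeff_α f = 0`: `|α| < δ ≤ ord f`
    rw [Jets.mem_maximalIdeal_iff_constantCoeff_eq_zero, constantCoeff_hasseDeriv]
    exact MvPowerSeries.coeff_of_lt_order (lt_of_lt_of_le (by exact_mod_cast (show α.degree < δ by omega)) hf)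
  · intro hmem
    have h1 := natCast_mul_coeff_eq_zero_of_hasseDeriv_mem_sq i hmem
    rcases mul_eq_zero.mp h1 with h2 | h2
    · apply hi
      rw [Finsupp.add_apply, single_eq_same]
      exact (CharP.cast_eq_zero_iff K p _).mp h2
    · exact hc h2

/-- **`p ∤ ord f` ⟹ some divided derivative of order `ord f − 1` has `𝔪`-adic order exactly `1`** (the TAME case: a monomial of degree
`ord f` occurs, and its exponents cannot all be divisible by `p` since their sum is not).
[cite: VillamayorU2008ReesDiff, §4.1 (element form; folklore computation)] -/
theorem exists_hasseDeriv_adicOrder_eq_one_of_not_dvd_order {f : MvPowerSeries σ K} {δ : ℕ} (hf : f.order = δ)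
    (hδ : ¬ p ∣ δ) :
    ∃ α : σ →₀ ℕ, α.degree + 1 = δ ∧ Literature.AlgebraicGeometry.Resolution.adicOrder (hasseDeriv α f) = 1 := by
  obtain ⟨⟨β, hc, hβ⟩, -⟩ := MvPowerSeries.order_eq_nat.mp hf
  obtain ⟨i, hi⟩ := exists_not_dvd_of_not_dvd_degree (p := p) (β := β) (hβ ▸ hδ)
  obtain ⟨α, -, hαδ, hord⟩ := exists_hasseDeriv_adicOrder_eq_one p hf.symm.le hβ hc hi
  exact ⟨α, hαδ, hord⟩

/-- **Characteristic `0`: a divided derivative of order `ord f − 1` ALWAYS reaches order exactly `1`** (`ord f = δ ≥ 1` finite; `CharP K 0`: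
`0 ∣ δ` only for `δ = 0`). [cite: VillamayorU2008ReesDiff, §4.1 (element form; folklore computation)] -/
theorem exists_hasseDeriv_adicOrder_eq_one_charZero [CharP K 0] {f : MvPowerSeries σ K} {δ : ℕ} (hf : f.order = δ) (hδ : δ ≠ 0) :
    ∃ α : σ →₀ ℕ, α.degree + 1 = δ ∧ Literature.AlgebraicGeometry.Resolution.adicOrder (hasseDeriv α f) = 1 :=
  exists_hasseDeriv_adicOrder_eq_one_of_not_dvd_order 0 hf (by rwa [zero_dvd_iff])

/-- **The WILD alternative, contrapositive form**: if every divided derivative of order `< ord f = δ` lies in `𝔪²`, then `p ∣ δ` and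
every degree-`δ` monomial of `f` has all exponents divisible by `p`. [cite: VillamayorU2008ReesDiff, §4.1 (element form; folklore computation)] -/
theorem dvd_order_of_forall_hasseDeriv_mem_sq [Finite σ] {f : MvPowerSeries σ K} {δ : ℕ} (hf : f.order = δ)
    (h : ∀ α : σ →₀ ℕ, α.degree < δ → hasseDeriv α f ∈ maximalIdeal (MvPowerSeries σ K) ^ 2) :
    p ∣ δ ∧ ∀ β : σ →₀ ℕ, β.degree = δ → coeff β f ≠ 0 → ∀ i, p ∣ β i := by
  have hall := (forall_hasseDeriv_mem_sq_iff p hf.symm.le).mp h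
  refine ⟨?_, hall⟩
  obtain ⟨⟨β, hc, hβ⟩, -⟩ := MvPowerSeries.order_eq_nat.mp hf
  rw [← hβ, Finsupp.degree_apply]
  exact Finset.dvd_sum fun i _ => hall β hβ hc i

end Field

end Literature.RingTheory.MvPowerSeries

end
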